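import Summits.Ventures.HSemireg.WedgeHankelRecurrenceGaussChebyshevGeneratingFunctions
import Mathlib.RingTheory.PowerSeries.Inverse

/-!
# Venture HSemireg — **FORMAL GENERATING FUNCTIONS IN `A⟦t⟧` FOR EVERY COMMUTATIVE RING `A` AND EVERY `x ∈ A`: `(1 − x·t + t²)·Σ_n S_n(x)tⁿ = 1`, `(1 − x·t + t²)·Σ_n C_n(x)tⁿ = 2 − x·t`,
# `(1 − 2x·t + t²)·Σ_n U_n(x)tⁿ = 1`, `(1 − 2x·t + t²)·Σ_n T_n(x)tⁿ = 1 − x·t`, and the SOLVED forms `Σ_n S_n(x)tⁿ = (1 − x·t + t²)⁻¹`, `Σ_n C_n(x)tⁿ = (2 − x·t)(1 − x·t + t²)⁻¹`, `Σ_n U_n(x)tⁿ =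
# (1 − 2x·t + t²)⁻¹`, `Σ_n T_n(x)tⁿ = (1 − x·t)(1 − 2x·t + t²)⁻¹` with `PowerSeries.invOfUnit`** (the SCALAR — evaluated at `x ∈ A` — companions of the tree's formal identities in `R[X]⟦u⟧`,
# `Literature.Algebra.Polynomial.ChebyshevCoefficientFormulas.chebyshev{T,U,C,S}_genFun`; coefficientwise these are the three-term recurrences with their initial values)

HONEST FRAMING. Part of the Lean index of the computation cell `pub-hsemireg` (seat p10 gen 49, Sunday typer «UNIFORM-IN-n»).  Formal power series algebra (Mathlib `PowerSeries.mk ∕ coeff ∕ C ∕ X`) over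
the Chebyshev recurrences; no variety, no cohomology theory, no sheaf, no Ext group and no semiregularity map is constructed here; nothing here says that HC / HC_CM / HC_AV holds; no Literature fact
(unproved `Prop`) is declared or used.  Custodian versions as in `WedgeHankelSiegelIdeal` (1/3).
SOURCES (cited).  T. J. Rivlin, *The Chebyshev Polynomials* (Wiley 1974), §1.5, (1.104)–(1.105); NIST DLMF §18.12, 18.12.8–18.12.10; A. F. Horadam, *Vieta polynomials*, Fibonacci Quart. 40 (2002)
223–232 (`Σ S_n tⁿ = 1∕(1 − xt + t²)`, `Σ C_n tⁿ = (2 − xt)∕(1 − xt + t²)`).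
PROOF TYPED HERE.  `PowerSeries.ext`: the coefficient of `tⁿ` in `(1 − x·t + t²)·Σ P_k t^k` is `P_n − x·P_{n−1} + P_{n−2}` (`PowerSeries.coeff_C_mul`, `coeff_succ_X_mul`, `coeff_X_pow_mul`,
`coeff_zero_X_mul`, `coeff_X_pow_mul'`), which vanishes for `n ≥ 2` by Mathlib `S_add_two ∕ C_add_two ∕ U_add_two ∕ T_add_two` at `x`; the cases `n = 0, 1` are the initial values.  The solved
forms: `1 − a·t + t²` has constant coefficient `1`, so `q·f = g ⇒ f = g·q⁻¹` with `q⁻¹ = PowerSeries.invOfUnit q 1` (Mathlib `PowerSeries.mul_invOfUnit`).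
DEDUP DISCLOSURE (`rg -n 'PowerSeries|genFun' Summits/Ventures/HSemireg Literature/Algebra/Polynomial -g '*.lean'`, 2026-09-04): the FORMAL identities with POLYNOMIAL coefficients, `(Σ_n P_n uⁿ)·(1 − (2)Xu + u²)
= 1 ∕ 1 − Xu ∕ 2 − Xu` in `R[X]⟦u⟧`, ARE in the tree: `Literature.Algebra.Polynomial.ChebyshevCoefficientFormulas` (`chebyshevT_genFun`, `chebyshevU_genFun`, `chebyshevC_genFun`, `chebyshevS_genFun`,
Rivlin (1.105)–(1.107); also the analytic `hasSum_chebyshevT_eval_mul_pow`).  The product identities below are their SCALAR companions (coefficients `P_n(x) ∈ A`; they follow from the Literature ones by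
`PowerSeries.map (Polynomial.evalRingHom x)`); that module does `import Mathlib`, so it is CITED and not imported into this chain, and the scalar forms are re-derived coefficientwise here (≈ 15 lines
each).  The solved `invOfUnit` forms are not typed anywhere (Mathlib `RingTheory/PowerSeries` has no Chebyshev entry; the chapter has no `PowerSeries` leaf).  N540 has the TRUNCATED identities.  0 hits
for the 11 names below.

WHAT IS IN THE TREE.  `Literature.Algebra.Polynomial.ChebyshevCoefficientFormulas.chebyshev{T,U,C,S}_genFun` (formal polynomial-coefficient versions, cited); N540 (truncated forms, not used here); Mathlib
`PowerSeries.ext`, `coeff_mk`, `coeff_one`, `coeff_C_mul`, `coeff_succ_X_mul`, `coeff_zero_X_mul`, `coeff_X_pow_mul`, `coeff_X_pow_mul'`, `coeff_C`, `coeff_X`, `PowerSeries.invOfUnit`, `mul_invOfUnit`,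
`S_add_two ∕ C_add_two ∕ U_add_two ∕ T_add_two`.
THIS FILE (namespace `Summit.Ventures.HSemireg.Wedge.HankelOuter` continued; CHAINED on N540; 0 definitions):
* §1306 `coeff_quadratic_mul_mk` (the coefficient of `tⁿ⁺²` in `(1 − a·t + t²)·Σ f_k t^k` is `f_{n+2} − a f_{n+1} + f_n`, with the `n = 0, 1` companions), **`chebyshevS_powerSeries`**
  (`(1 − x t + t²)·mk(S_n(x)) = 1`), **`chebyshevC_powerSeries`** (`= 2 − x t`), **`chebyshevU_powerSeries`** (`(1 − 2x t + t²)·mk(U_n(x)) = 1`), **`chebyshevT_powerSeries`** (`= 1 − x t`);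
  `constantCoeff_one_sub_C_mul_X_add_X_sq`, `powerSeries_eq_mul_invOfUnit` (`q₀ = 1`, `q·f = g ⇒ f = g·q⁻¹`), **`chebyshevS_powerSeries_eq_invOfUnit`**, **`chebyshevC_powerSeries_eq_mul_invOfUnit`**,
  **`chebyshevU_powerSeries_eq_invOfUnit`**, **`chebyshevT_powerSeries_eq_mul_invOfUnit`** (the solved forms of the title).
CAVEATS.  `t` is `PowerSeries.X`; `x ∈ A` arbitrary; inverses as `PowerSeries.invOfUnit _ 1` (no field assumed).  Nothing Ext-side.  New names only.
-/

open Module Polynomial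
open scoped Matrix Polynomial

namespace Summit.Ventures.HSemireg.Wedge.HankelOuter

/-! ## §1306. Formal generating functions -/

/-- Coefficients of `(1 − a·t + t²)·Σ_k f_k t^k`: `f_0` at `t⁰`, `f_1 − a f_0` at `t¹`, `f_{n+2} − a f_{n+1} + f_n` at `tⁿ⁺²`. [this file, §1306] -/
theorem coeff_quadratic_mul_mk {A : Type*} [CommRing A] (a : A) (f : ℕ → A) :
    PowerSeries.coeff 0 ((1 - PowerSeries.C a * PowerSeries.X + PowerSeries.X ^ 2) * PowerSeries.mk f) = f 0 ∧
      PowerSeries.coeff 1 ((1 - PowerSeries.C a * PowerSeries.X + PowerSeries.X ^ 2) * PowerSeries.mk f) = f 1 - a * f 0 ∧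
      ∀ n : ℕ, PowerSeries.coeff (n + 2) ((1 - PowerSeries.C a * PowerSeries.X + PowerSeries.X ^ 2) * PowerSeries.mk f) = f (n + 2) - a * f (n + 1) + f n := by
  refine ⟨?_, ?_, fun n => ?_⟩
  · rw [add_mul, sub_mul, one_mul, map_add, map_sub, mul_assoc, PowerSeries.coeff_C_mul, PowerSeries.coeff_zero_X_mul, PowerSeries.coeff_X_pow_mul', if_neg (by omega),
      PowerSeries.coeff_mk]
    ring
  · rw [add_mul, sub_mul, one_mul, map_add, map_sub, mul_assoc, PowerSeries.coeff_C_mul, show (1 : ℕ) = 0 + 1 from rfl, PowerSeries.coeff_succ_X_mul,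
      PowerSeries.coeff_X_pow_mul', if_neg (by omega), PowerSeries.coeff_mk, PowerSeries.coeff_mk]
    ring
  · rw [add_mul, sub_mul, one_mul, map_add, map_sub, mul_assoc, PowerSeries.coeff_C_mul, show n + 2 = (n + 1) + 1 from rfl, PowerSeries.coeff_succ_X_mul,
      show n + 1 + 1 = n + 2 from rfl, PowerSeries.coeff_X_pow_mul, PowerSeries.coeff_mk, PowerSeries.coeff_mk, PowerSeries.coeff_mk]

/-- **`(1 − x·t + t²)·Σ_n S_n(x) tⁿ = 1` in `A⟦t⟧`** for every commutative ring `A` and `x ∈ A`. [Horadam 2002; Rivlin 1974, §1.5; this file, §1306] -/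
theorem chebyshevS_powerSeries {A : Type*} [CommRing A] (x : A) :
    (1 - PowerSeries.C x * PowerSeries.X + PowerSeries.X ^ 2) * PowerSeries.mk (fun n => (Polynomial.Chebyshev.S A (n : ℤ)).eval x) = 1 := by
  obtain ⟨h0, h1, h2⟩ := coeff_quadratic_mul_mk x (fun n => (Polynomial.Chebyshev.S A (n : ℤ)).eval x)
  ext n
  rw [PowerSeries.coeff_one]
  match n with
  | 0 =>
    rw [h0, if_pos rfl]
    simp
  | 1 =>
    rw [h1, if_neg (by omega)]
    simp
  | n + 2 =>
    rw [h2, if_neg (by omega)]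
    have h := congrArg (Polynomial.eval x) (Polynomial.Chebyshev.S_add_two A (n : ℤ))
    simp only [eval_sub, eval_mul, eval_X] at h
    push_cast
    linear_combination h

/-- **`(1 − x·t + t²)·Σ_n C_n(x) tⁿ = 2 − x·t` in `A⟦t⟧`.** [Horadam 2002; this file, §1306] -/
theorem chebyshevC_powerSeries {A : Type*} [CommRing A] (x : A) :
    (1 - PowerSeries.C x * PowerSeries.X + PowerSeries.X ^ 2) * PowerSeries.mk (fun n => (Polynomial.Chebyshev.C A (n : ℤ)).eval x) = 2 - PowerSeries.C x * PowerSeries.X := by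
  obtain ⟨h0, h1, h2⟩ := coeff_quadratic_mul_mk x (fun n => (Polynomial.Chebyshev.C A (n : ℤ)).eval x)
  ext n
  rw [map_sub, PowerSeries.coeff_C_mul, PowerSeries.coeff_X, ← map_ofNat (PowerSeries.C (R := A)) 2, PowerSeries.coeff_C]
  match n with
  | 0 =>
    rw [h0, if_pos rfl, if_neg (by omega)]
    simp
  | 1 =>
    rw [h1, if_neg (by omega), if_pos rfl]
    simp
    ring
  | n + 2 =>
    rw [h2, if_neg (by omega), if_neg (by omega)]
    have h := congrArg (Polynomial.eval x) (Polynomial.Chebyshev.C_add_two A (n : ℤ))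
    simp only [eval_sub, eval_mul, eval_X] at h
    push_cast
    linear_combination h

/-- **`(1 − 2x·t + t²)·Σ_n U_n(x) tⁿ = 1` in `A⟦t⟧`.** [Rivlin 1974, (1.105); DLMF 18.12.10; this file, §1306] -/
theorem chebyshevU_powerSeries {A : Type*} [CommRing A] (x : A) :
    (1 - PowerSeries.C (2 * x) * PowerSeries.X + PowerSeries.X ^ 2) * PowerSeries.mk (fun n => (Polynomial.Chebyshev.U A (n : ℤ)).eval x) = 1 := by
  obtain ⟨h0, h1, h2⟩ := coeff_quadratic_mul_mk (2 * x) (fun n => (Polynomial.Chebyshev.U A (n : ℤ)).eval x)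
  ext n
  rw [PowerSeries.coeff_one]
  match n with
  | 0 =>
    rw [h0, if_pos rfl]
    simp
  | 1 =>
    rw [h1, if_neg (by omega)]
    simp
  | n + 2 =>
    rw [h2, if_neg (by omega)]
    have h := congrArg (Polynomial.eval x) (Polynomial.Chebyshev.U_add_two A (n : ℤ))
    simp only [eval_sub, eval_mul, eval_ofNat, eval_X] at h
    push_cast
    linear_combination h

/-- **`(1 − 2x·t + t²)·Σ_n T_n(x) tⁿ = 1 − x·t` in `A⟦t⟧`.** [Rivlin 1974, (1.104); DLMF 18.12.8; this file, §1306] -/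
theorem chebyshevT_powerSeries {A : Type*} [CommRing A] (x : A) :
    (1 - PowerSeries.C (2 * x) * PowerSeries.X + PowerSeries.X ^ 2) * PowerSeries.mk (fun n => (Polynomial.Chebyshev.T A (n : ℤ)).eval x) = 1 - PowerSeries.C x * PowerSeries.X := by
  obtain ⟨h0, h1, h2⟩ := coeff_quadratic_mul_mk (2 * x) (fun n => (Polynomial.Chebyshev.T A (n : ℤ)).eval x)
  ext n
  rw [map_sub, PowerSeries.coeff_C_mul, PowerSeries.coeff_X, PowerSeries.coeff_one]
  match n with
  | 0 =>
    rw [h0, if_pos rfl, if_neg (by omega)]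
    simp
  | 1 =>
    rw [h1, if_neg (by omega), if_pos rfl]
    simp
    ring
  | n + 2 =>
    rw [h2, if_neg (by omega), if_neg (by omega)]
    have h := congrArg (Polynomial.eval x) (Polynomial.Chebyshev.T_add_two A (n : ℤ))
    simp only [eval_sub, eval_mul, eval_ofNat, eval_X] at h
    push_cast
    linear_combination h

/-- `1 − a·t + t²` has constant coefficient `1`. [this file, §1306] -/
theorem constantCoeff_one_sub_C_mul_X_add_X_sq {A : Type*} [CommRing A] (a : A) :
    PowerSeries.constantCoeff (1 - PowerSeries.C a * PowerSeries.X + PowerSeries.X ^ 2) = 1 := by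
  simp

/-- If `q` has constant coefficient `1` and `q·f = g` in `A⟦t⟧`, then `f = g·q⁻¹` with `q⁻¹ = PowerSeries.invOfUnit q 1`. [this file, §1306] -/
theorem powerSeries_eq_mul_invOfUnit {A : Type*} [CommRing A] {q f g : PowerSeries A} (hq : PowerSeries.constantCoeff q = 1) (h : q * f = g) :
    f = g * PowerSeries.invOfUnit q 1 := by
  have h1 : q * PowerSeries.invOfUnit q 1 = 1 := PowerSeries.mul_invOfUnit q 1 (by rw [hq, Units.val_one])
  calc f = f * (q * PowerSeries.invOfUnit q 1) := by rw [h1, mul_one]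
    _ = q * f * PowerSeries.invOfUnit q 1 := by ring
    _ = g * PowerSeries.invOfUnit q 1 := by rw [h]

/-- **`Σ_n S_n(x) tⁿ = (1 − x·t + t²)⁻¹` in `A⟦t⟧`** (inverse as `PowerSeries.invOfUnit _ 1`). [Horadam 2002; Rivlin 1974, (1.106)–(1.107); this file, §1306] -/
theorem chebyshevS_powerSeries_eq_invOfUnit {A : Type*} [CommRing A] (x : A) :
    PowerSeries.mk (fun n => (Polynomial.Chebyshev.S A (n : ℤ)).eval x) = PowerSeries.invOfUnit (1 - PowerSeries.C x * PowerSeries.X + PowerSeries.X ^ 2) 1 := by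
  have h := powerSeries_eq_mul_invOfUnit (constantCoeff_one_sub_C_mul_X_add_X_sq x) (chebyshevS_powerSeries x)
  rwa [one_mul] at h

/-- **`Σ_n C_n(x) tⁿ = (2 − x·t)·(1 − x·t + t²)⁻¹` in `A⟦t⟧`.** [Horadam 2002; Rivlin 1974, (1.106); this file, §1306] -/
theorem chebyshevC_powerSeries_eq_mul_invOfUnit {A : Type*} [CommRing A] (x : A) :
    PowerSeries.mk (fun n => (Polynomial.Chebyshev.C A (n : ℤ)).eval x) =
      (2 - PowerSeries.C x * PowerSeries.X) * PowerSeries.invOfUnit (1 - PowerSeries.C x * PowerSeries.X + PowerSeries.X ^ 2) 1 :=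
  powerSeries_eq_mul_invOfUnit (constantCoeff_one_sub_C_mul_X_add_X_sq x) (chebyshevC_powerSeries x)

/-- **`Σ_n U_n(x) tⁿ = (1 − 2x·t + t²)⁻¹` in `A⟦t⟧`.** [Rivlin 1974, (1.105), Ex. 1.5.19; DLMF 18.12.10; this file, §1306] -/
theorem chebyshevU_powerSeries_eq_invOfUnit {A : Type*} [CommRing A] (x : A) :
    PowerSeries.mk (fun n => (Polynomial.Chebyshev.U A (n : ℤ)).eval x) = PowerSeries.invOfUnit (1 - PowerSeries.C (2 * x) * PowerSeries.X + PowerSeries.X ^ 2) 1 := by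
  have h := powerSeries_eq_mul_invOfUnit (constantCoeff_one_sub_C_mul_X_add_X_sq (2 * x)) (chebyshevU_powerSeries x)
  rwa [one_mul] at h

/-- **`Σ_n T_n(x) tⁿ = (1 − x·t)·(1 − 2x·t + t²)⁻¹` in `A⟦t⟧`.** [Rivlin 1974, (1.105); DLMF 18.12.8; this file, §1306] -/
theorem chebyshevT_powerSeries_eq_mul_invOfUnit {A : Type*} [CommRing A] (x : A) :
    PowerSeries.mk (fun n => (Polynomial.Chebyshev.T A (n : ℤ)).eval x) =
      (1 - PowerSeries.C x * PowerSeries.X) * PowerSeries.invOfUnit (1 - PowerSeries.C (2 * x) * PowerSeries.X + PowerSeries.X ^ 2) 1 :=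
  powerSeries_eq_mul_invOfUnit (constantCoeff_one_sub_C_mul_X_add_X_sq (2 * x)) (chebyshevT_powerSeries x)

end Summit.Ventures.HSemireg.Wedge.HankelOuter
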